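import Literature.AlgebraicTopology.SingularHomology.ExcisionMayerVietoris
import Literature.AlgebraicTopology.SingularHomology.LocalHomology
import Literature.AlgebraicTopology.SingularHomology.CapProduct
import Mathlib.Analysis.Normed.Module.Connected
import HarnessLib

/-!
# The vanishing homology of spheres: discharge of `Literature.AlgebraicTopology.SingularHomology.isZero_singularHomology_sphere`

Sibling proof file of `ExcisionMayerVietoris.lean`, which states as a named fact (D-0014)
`Literature.isZero_singularHomology_sphere R M : Hₖ(𝕊ⁿ; M) = 0` for `k ≠ 0, n`
(A. Hatcher, *Algebraic Topology*, CUP 2002, Cor. 2.14, p. 114: "`H̃ₙ(Sⁿ) ≈ ℤ` and `H̃ᵢ(Sⁿ) = 0`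
for `i ≠ n`"). Here that fact is **proved**, for every commutative ring `R` and `R`-module `M`:
`Literature.AlgebraicTopology.SingularHomology.isZero_singularHomology_sphere_holds`.

The proof is Hatcher's second computation of the homology of spheres, Example 2.46 (§2.2,
Mayer–Vietoris for the two enlarged hemispheres, "we obtain isomorphisms
`H̃ᵢ(Sⁿ) ≈ H̃ᵢ₋₁(Sⁿ⁻¹)` … by induction"), in the model `Sⁿ ≃ ℝⁿ⁺¹ ∖ {0}` of
`Literature…PuncturedEuclidean` and on the concrete chain complex of
`Literature…SingularChainsConcrete`, using the tool kit PROVED in `Literature…LocalHomology`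
(small chains, Prop. 2.21; the concrete Mayer–Vietoris sequence `Literature.AlgebraicTopology.SingularHomology.mvSES`; the slit
decomposition `ℝᵏ⁺¹ ∖ {0} = A ∪ B` into two open star-shaped sets with `A ∩ B ≃ ℝᵏ ∖ {0}`; the
resulting `Literature.puncturedSuccIso : Hⱼ₊₁(ℝᵏ⁺¹ ∖ 0) ≅ Hⱼ(ℝᵏ ∖ 0)` for `j ≥ 1` and
`Literature.isZero_homology_punctured : Hⱼ(ℝᵏ ∖ 0) = 0` for `j ≥ k`, `j ≥ 1`). What `LocalHomology` does not
contain is the bottom of the induction, the degree-one groups: `H₁(ℝᵐ ∖ 0) = 0` for `m ≥ 3`, whose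
Mayer–Vietoris argument meets `H₀` (reduced homology). We supply it:

* `Literature.AlgebraicTopology.SingularHomology.singularHomology.mono_map_zero_of_pathConnectedSpace`,
  `Literature.AlgebraicTopology.SingularHomology.csingularHomology.mono_map_zero_of_pathConnectedSpace`, `Literature.AlgebraicTopology.SingularHomology.mono_homologyMap_incl_zero`:
  a map out of a nonempty path-connected space is injective on `H₀` (Hatcher Prop. 2.7: the
  augmentation `ε : H₀ → M` is an isomorphism for path-connected spaces, and is natural,
  `Literature.AlgebraicTopology.SingularHomology.singularHomology.map_ε`);
* `Literature.AlgebraicTopology.SingularHomology.isZero_one_of_mv`: **Mayer–Vietoris in degree one** — for open `A`, `B` with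
  `H₁(A) = H₁(B) = 0` and `A ∩ B` path-connected, `H₁(A ∪ B) = 0` (the connecting map
  `H₁(A ∪ B) → H₀(A ∩ B)` is injective and, `H₀(A ∩ B) → H₀(A) ⊕ H₀(B)` being injective, zero);
* `Literature.AlgebraicTopology.SingularHomology.isPathConnected_slitInter`: `A ∩ B = {v | (v₀, …, vₖ₋₁) ≠ 0} ≅ (ℝᵏ ∖ 0) × ℝ` is
  path-connected for `k ≥ 2`;
* `Literature.AlgebraicTopology.SingularHomology.isZero_homology_punctured_succ_one` (`H₁(ℝᵏ⁺¹ ∖ 0) = 0`, `k ≥ 2`),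
  `Literature.AlgebraicTopology.SingularHomology.isZero_homology_punctured_of_succ_ne` (`Hⱼ(ℝⁿ ∖ 0) = 0` for `j ≥ 1`, `j + 1 ≠ n`),
  `Literature.AlgebraicTopology.SingularHomology.isZero_csingularHomology_unitSphere`, `Literature.AlgebraicTopology.SingularHomology.isZero_singularHomology_unitSphere`
  (`Hₖ(Sⁿ; M) = 0` for `k ≠ 0, n`, concrete and Mathlib models), and the discharge
  `Literature.AlgebraicTopology.SingularHomology.isZero_singularHomology_sphere_holds`.

Everything is proved; no new definitions.

## References

* A. Hatcher, *Algebraic Topology*, CUP 2002, §2.1 Prop. 2.7, Cor. 2.14 (p. 114); §2.2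
  Mayer–Vietoris sequences (pp. 149–150), Example 2.46 [HatcherAT2002].
-/

noncomputable section

open CategoryTheory Limits

universe u v

namespace Literature.AlgebraicTopology.SingularHomology

variable (R : Type v) [CommRing R] (M : Type v) [AddCommGroup M] [Module R M]

/-! ### `H₀` of a map out of a path-connected space is injective -/

section MonoZero

variable {X Y : Type u} [TopologicalSpace X] [TopologicalSpace Y]

/-- For a nonempty path-connected space `X` and any map `f : X → Y`, `f_* : H₀(X; M) → H₀(Y; M)`
is injective (Hatcher 2002, Prop. 2.7 and its proof: `ε ∘ f_* = ε` with `ε : H₀(X; M) ≅ M`).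
[cite: HatcherAT2002, Prop. 2.7] -/
theorem singularHomology.mono_map_zero_of_pathConnectedSpace [PathConnectedSpace X]
    (f : C(X, Y)) : Mono (singularHomology.map R M f 0) := by
  haveI : IsIso (singularHomology.ε R M X) := singularHomology.isIso_ε_of_pathConnectedSpace R M
  exact mono_of_mono_fac (singularHomology.map_ε (R := R) (M := M) f)

/-- Concrete model: for a nonempty path-connected `X` and any `f : X → Y`,
`f_* : H₀(X; M) → H₀(Y; M)` is injective (Hatcher 2002, Prop. 2.7). [cite: HatcherAT2002, Prop. 2.7] -/
theorem csingularHomology.mono_map_zero_of_pathConnectedSpace [PathConnectedSpace X]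
    (f : C(X, Y)) : Mono (csingularHomology.map R M f 0) := by
  haveI := singularHomology.mono_map_zero_of_pathConnectedSpace R M f
  rw [csingularHomology.map_eq_conj]
  infer_instance

/-- Subcomplex form: for nested subspaces `A ⊆ B` of `X` with `A` nonempty and path-connected,
the inclusion of subcomplexes `C(A) ↪ C(B)` of chains in `A`, resp. `B`, is injective on `H₀`
(it is conjugate to `H₀(↥A) → H₀(↥B)`, `Literature.AlgebraicTopology.SingularHomology.clocalHomology.subspaceLift_comp_incl`).
[cite: HatcherAT2002, Prop. 2.7] -/
theorem mono_homologyMap_incl_zero {A B : Set X} (h : A ⊆ B) [PathConnectedSpace A] :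
    Mono (HomologicalComplex.homologyMap (Subcomplex.incl (chainsInSub_mono R M h)) 0) := by
  have e : HomologicalComplex.homologyMap (Subcomplex.incl (chainsInSub_mono R M h)) 0 =
      HomologicalComplex.homologyMap (inv (subspaceLift R M X A)) 0 ≫
        csingularHomology.map R M (⟨Set.inclusion h, continuous_inclusion h⟩ : C(A, B)) 0 ≫
          HomologicalComplex.homologyMap (subspaceLift R M X B) 0 := by
    rw [csingularHomology.map, ← HomologicalComplex.homologyMap_comp,
      ← HomologicalComplex.homologyMap_comp, ← clocalHomology.subspaceLift_comp_incl,
      IsIso.inv_hom_id_assoc]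
  haveI := csingularHomology.mono_map_zero_of_pathConnectedSpace R M
    (⟨Set.inclusion h, continuous_inclusion h⟩ : C(A, B))
  rw [e]
  infer_instance

end MonoZero

/-! ### Mayer–Vietoris in degree one -/

section MayerVietorisOne

variable {X : Type u} [TopologicalSpace X] {A B : Set X}

/-- **Mayer–Vietoris in degree one** (Hatcher 2002, §2.2, pp. 149–150, reduced form): for open
`A`, `B ⊆ X` with `H₁(A; M) = H₁(B; M) = 0` and `A ∩ B` nonempty and path-connected,
`H₁(A ∪ B; M) = 0`. In the exact sequence
`H₁(A) ⊕ H₁(B) → H₁(A ∪ B) →∂ H₀(A ∩ B) → H₀(A) ⊕ H₀(B)` the first term vanishes, so `∂` is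
injective, and the last map is injective (`A ∩ B` path-connected), so `∂ = 0`.
[cite: HatcherAT2002, §2.2 pp. 149–150] -/
theorem isZero_one_of_mv (hA : IsOpen A) (hB : IsOpen B)
    (hA1 : IsZero (csingularHomology R M A 1)) (hB1 : IsZero (csingularHomology R M B 1))
    (hAB : IsPathConnected (A ∩ B)) : IsZero (csingularHomology R M ↥(A ∪ B) 1) := by
  haveI : PathConnectedSpace ↥(A ∩ B) := isPathConnected_iff_pathConnectedSpace.mp hAB
  -- `H₀(C(A ∩ B)) → H₀(C(A))` is injective (the source written as `C(A) ⊓ C(B)`)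
  have key : ∀ (U : Subcomplex (csingularChainComplex R M X))
      (_ : chainsInSub R M X (A ∩ B) = U) (hU : U ≤ chainsInSub R M X A),
      Mono (HomologicalComplex.homologyMap (Subcomplex.incl hU) 0) := by
    rintro U rfl hU
    exact mono_homologyMap_incl_zero R M Set.inter_subset_left
  have h1 : Mono (HomologicalComplex.homologyMap
      (Subcomplex.incl (inf_le_left : chainsInSub R M X A ⊓ chainsInSub R M X B ≤ _)) 0) :=
    key _ (chainsInSub_inter R M A B) inf_le_left
  -- hence so is `H₀` of the first Mayer–Vietoris map `x ↦ (x, x)` (it factors the former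
  -- through the first projection)
  have hmono : Mono (HomologicalComplex.homologyMap
      (Subcomplex.mvSubF (chainsInSub R M X A) (chainsInSub R M X B)) 0) := by
    have w : HomologicalComplex.homologyMap
          (Subcomplex.mvSubF (chainsInSub R M X A) (chainsInSub R M X B)) 0 ≫
        HomologicalComplex.homologyMap (biprod.fst :
          (chainsInSub R M X A).toComplex ⊞ (chainsInSub R M X B).toComplex ⟶ _) 0 =
        HomologicalComplex.homologyMap (Subcomplex.incl
          (inf_le_left : chainsInSub R M X A ⊓ chainsInSub R M X B ≤ _)) 0 := by
      rw [← HomologicalComplex.homologyMap_comp]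
      exact congrArg (HomologicalComplex.homologyMap · 0) (biprod.lift_fst _ _)
    refine ⟨fun u v huv => h1.right_cancellation u v ?_⟩
    simpa only [Category.assoc, w] using congrArg (· ≫ HomologicalComplex.homologyMap
      (biprod.fst : (chainsInSub R M X A).toComplex ⊞ (chainsInSub R M X B).toComplex ⟶ _) 0) huv
  have hS := mvSES_shortExact R M A B
  -- the connecting map `H₁(X₃) → H₀(X₁)` vanishes ...
  have hδ : hS.δ 1 0 rfl = 0 := (hS.homology_exact₁ 1 0 rfl).mono_g_iff.mp hmono
  -- ... and is injective, as `H₁(X₂) = H₁(C(A)) ⊕ H₁(C(B)) = 0`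
  have h2 : IsZero ((mvSES R M X A B).X₂.homology 1) := isZero_mvX₂_homology R M A B 1 hA1 hB1
  have h3 : IsZero ((mvSES R M X A B).X₃.homology 1) :=
    (hS.homology_exact₃ 1 0 rfl).isZero_X₂ (h2.eq_of_src _ _) hδ
  exact h3.of_iso (mvUnionHomologyIso R M hA hB 1).symm

end MayerVietorisOne

/-! ### `H₁(ℝᵐ ∖ {0}) = 0` for `m ≥ 3`, and all the vanishing homology of `ℝⁿ ∖ {0}` -/

section Punctured

/-- `ℝᵏ ∖ {0}` is path-connected for `k ≥ 2` (Mathlib's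
`isPathConnected_compl_singleton_of_one_lt_rank`). [folklore] -/
theorem isPathConnected_punctured (k : ℕ) (hk : 2 ≤ k) : IsPathConnected (punctured k) := by
  have hp : punctured k = {(0 : RVec k)}ᶜ := by
    ext v
    rw [mem_punctured, Set.mem_compl_singleton_iff]
  rw [hp]
  refine isPathConnected_compl_singleton_of_one_lt_rank ?_ 0
  rw [rank_fin_fun]
  exact_mod_cast hk

/-- The doubly slit set `A ∩ B = {v ∈ ℝᵏ⁺¹ | (v₀, …, vₖ₋₁) ≠ 0}` of the slit decomposition of
`ℝᵏ⁺¹ ∖ {0}` is path-connected for `k ≥ 2`: it is the image of `(ℝᵏ ∖ {0}) × ℝ` under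
`(w, t) ↦ (w, t)`. [folklore] -/
theorem isPathConnected_slitInter (k : ℕ) (hk : 2 ≤ k) :
    IsPathConnected (slitUp k ∩ slitDown k) := by
  rw [slitUp_inter_slitDown]
  have himg : {v : RVec (k + 1) | Fin.init v ≠ 0} =
      (fun p : RVec k × ℝ => (Fin.snoc p.1 p.2 : RVec (k + 1))) '' (punctured k ×ˢ Set.univ) := by
    ext v
    constructor
    · intro hv
      exact ⟨(Fin.init v, v (Fin.last k)), ⟨hv, Set.mem_univ _⟩, Fin.snoc_init_self v⟩
    · rintro ⟨⟨w, t⟩, ⟨hw, -⟩, rfl⟩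
      rw [Set.mem_setOf_eq, Fin.init_snoc]
      exact hw
  rw [himg]
  exact ((isPathConnected_punctured k hk).prod isPathConnected_univ).image
    (Continuous.finSnoc (A := fun _ : Fin (k + 1) => ℝ) continuous_fst continuous_snd)

/-- **`H₁(ℝᵏ⁺¹ ∖ {0}; M) = 0` for `k ≥ 2`** (Hatcher 2002, Example 2.46 / Cor. 2.14 in the model
`ℝᵏ⁺¹ ∖ {0} ≃ Sᵏ`: `H₁(Sᵏ) = 0` for `k ≥ 2`): Mayer–Vietoris in degree one for the slit
decomposition, whose pieces are contractible and whose intersection is path-connected.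
[cite: HatcherAT2002, Example 2.46] -/
theorem isZero_homology_punctured_succ_one (k : ℕ) (hk : 2 ≤ k) :
    IsZero (csingularHomology R M ↥(punctured (k + 1)) 1) :=
  (isZero_one_of_mv R M (isOpen_slitUp k) (isOpen_slitDown k)
      (isZero_homology_slitUp R M k one_ne_zero) (isZero_homology_slitDown R M k one_ne_zero)
      (isPathConnected_slitInter k hk)).of_iso
    (unionSlitIso R M k 1).symm

/-- **`Hⱼ(ℝⁿ ∖ {0}; M) = 0` for `j ≥ 1` and `j + 1 ≠ n`** (Hatcher 2002, Cor. 2.14 /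
Example 2.46 in the model `ℝⁿ ∖ {0} ≃ Sⁿ⁻¹`: `H̃ⱼ(Sⁿ⁻¹) = 0` for `j ≠ n - 1`): by induction on `j`,
descending along `Hⱼ₊₁(ℝᵏ⁺¹ ∖ 0) ≅ Hⱼ(ℝᵏ ∖ 0)` (`Literature.AlgebraicTopology.SingularHomology.puncturedSuccIso`) to the degree-one case
`Literature.AlgebraicTopology.SingularHomology.isZero_homology_punctured_succ_one`, the range `j ≥ n` being `Literature.AlgebraicTopology.SingularHomology.isZero_homology_punctured`.
[cite: HatcherAT2002, Cor. 2.14] -/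
theorem isZero_homology_punctured_of_succ_ne :
    ∀ (j n : ℕ), 1 ≤ j → j + 1 ≠ n → IsZero (csingularHomology R M ↥(punctured n) j)
  | 0, _, h, _ => absurd h (by omega)
  | 1, n, _, hn => by
    by_cases hle : n ≤ 1
    · exact isZero_homology_punctured R M n 1 hle le_rfl
    · obtain ⟨k, rfl⟩ : ∃ k, n = k + 1 := ⟨n - 1, by omega⟩
      exact isZero_homology_punctured_succ_one R M k (by omega)
  | j + 2, n, _, hn => by
    by_cases hle : n ≤ j + 2
    · exact isZero_homology_punctured R M n (j + 2) hle (by omega)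
    · obtain ⟨k, rfl⟩ : ∃ k, n = k + 1 := ⟨n - 1, by omega⟩
      exact (isZero_homology_punctured_of_succ_ne (j + 1) k (by omega) (by omega)).of_iso
        (puncturedSuccIso R M k (j + 1) (by omega))

end Punctured

/-! ### Spheres -/

section Sphere

/-- **`Hₖ(Sⁿ; M) = 0` for `k ≠ 0, n`**, concrete model, for the unit sphere `Sⁿ` of
`EuclideanSpace ℝ (Fin (n + 1))` (Hatcher 2002, Cor. 2.14), via the radial homotopy equivalence
`Sⁿ ≃ ℝⁿ⁺¹ ∖ {0}` (`Literature.AlgebraicTopology.SingularHomology.sphereHomotopyEquivPunctured`). [cite: HatcherAT2002, Cor. 2.14] -/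
theorem isZero_csingularHomology_unitSphere (n k : ℕ) (hk : k ≠ 0) (hkn : k ≠ n) :
    IsZero (csingularHomology R M ↥(unitSphere (n + 1)) k) :=
  (isZero_homology_punctured_of_succ_ne R M k (n + 1) (Nat.one_le_iff_ne_zero.mpr hk)
      (by omega)).of_iso
    (csingularHomology.isoOfHomotopyEquiv R M (sphereHomotopyEquivPunctured (n + 1)) k)

/-- **`Hₖ(Sⁿ; M) = 0` for `k ≠ 0, n`** for Mathlib's singular homology `Literature.AlgebraicTopology.SingularHomology.singularHomology` of
the unit sphere `Sⁿ ⊆ EuclideanSpace ℝ (Fin (n + 1))` (Hatcher 2002, Cor. 2.14).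
[cite: HatcherAT2002, Cor. 2.14] -/
theorem isZero_singularHomology_unitSphere (n k : ℕ) (hk : k ≠ 0) (hkn : k ≠ n) :
    IsZero (singularHomology R M ↥(unitSphere (n + 1)) k) :=
  (isZero_csingularHomology_unitSphere R M n k hk hkn).of_iso
    (csingularHomology.compIso R M _ k).symm

/-- **Discharge of the named fact `Literature.AlgebraicTopology.SingularHomology.isZero_singularHomology_sphere`** (Hatcher 2002,
Cor. 2.14, p. 114: `H̃ᵢ(Sⁿ) = 0` for `i ≠ n`; here `Hₖ(𝕊ⁿ; M) = 0` for `k ≠ 0, n`, any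
commutative ring `R` and `R`-module `M`). [cite: HatcherAT2002, Cor. 2.14] -/
theorem isZero_singularHomology_sphere_holds : isZero_singularHomology_sphere R M := by
  intro n k hk hkn
  exact isZero_singularHomology_unitSphere R M n k hk hkn

end Sphere

end Literature.AlgebraicTopology.SingularHomology

end
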